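import Summits.QuantumFields.YangMills.Theorems.FluctuationComparisonRegPrIntLS2BetaSmallBondGaugeCurvatureFloor
import HarnessLib

/-!
# S2β · D-GUARD, UPPER SIDE — NO VOLUME-UNIFORM SMALL-BOND GAUGE WITH A THRESHOLD LINEAR IN THE PLAQUETTE SIZE: the kernel form of «the target order is `√θ`, not `θ`»
# (UV3-NODE §114.3), a forty-line corollary of px17 g23's curvature floor ✓`…SmallBondGaugeCurvatureFloor.not_smallBond_supplier_T3`

Cell `ym3-torus` (YM ladder rung R3 = continuum `SU(2)` Yang–Mills on the three-torus at fixed lattice data — a RUNG: NOT d = 4, NOT infinite volume, NOT a mass gap,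
NOT Clay).  Width seat `ym-ust-20520-w4` (gen 28) on crux `stmt-QuantumFields-20520` (`FluctuationComparisonRegPrIntL`; registry `Lines/semiclassical_s2beta.lean` UNTOUCHED, 0∕5),
count-neutral, DEFINITION-FREE, default heartbeats; `--kind proof --supports stmt-QuantumFields-20520 --as helper`.  NAMED by LEAD w3 g29 №32 (3) «(y) GO» (STATUS
2026-08-31T23:35:57Z) after DESK RULING №117 «ONE DISC WITNESS, ONE PEN» (px17 g23 holds the witness file (W1) = ✓`…SmallBondGaugeCurvatureFloor`; this file is its follow-up, not a
second witness).

WHAT.  (W1) proves, for every torus `F.P J` with `N` sites per direction and all `k, s` with `4ks² ≤ N`: some datum with all plaquettes within any `θ > 2πk∕N` of `1` has, in EVERY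
gauge, a bond of arc `≥ ks∕N`; so a supplier promising bonds `≤ s₀` fails once `s₀ < ks∕N`.  Reading `k = 1`, `N ≈ 4s²`, `θ ≈ 4π∕N`: the floor is `≈ √θ∕(4√π)` while a LINEAR
threshold offers only `C·θ ≈ 4πC∕N` — smaller as soon as `s > 4πC`.  THIS FILE fixes that arithmetic once:
* `two_mul_three_pow_gt` — `4s² < 2·3^{2s²}` (the family `⟨3, 2s²⟩` is large enough);
* ★ `exists_family_linear_supplier_fails (C)` — for EVERY real `C` an explicit family `F = ⟨3, 2s²⟩`, `s = ⌈4πC⌉₊ + 1`, the height `J = 0` and the threshold `θ = 4π∕N` (`N = 2·3^{2s²}`)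
  at which «every `PlaqSmall θ` datum has a gauge copy with all bond arcs `≤ C·θ`» is FALSE;
* ★★★ `not_linear_smallBond_supplier` — hence **`¬ ∃ C, ∀ (F : T3Family) (J : ℕ) (θ > 0) (V : GaugeField (F.P J) 0 SU2), PlaqSmall θ V → ∃ u, ∀ e, ‖logVec (su2Quat ((u•V) e))‖ ≤ C·θ`**:
  no volume-uniform small-bond gauge supplier has a target threshold LINEAR in the plaquette window (the order must be at least `√θ`);
* ★ `not_linear_smallBond_supplier_dist1` — the same in the `dist1` currency (`arc ≤ (π∕2)·dist1`, ✓`norm_logVec_le_pi_div_two_mul_dist1`).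
DOMAIN SENTENCE (DESK RULING №115 (R5)): an UPPER-side necessary condition on the target threshold of any `hsupp` supplier, at every `(F.m, J)`; it supplies nothing and refutes no
landed declaration (px12's N∕Q∕S, the knits, the WLOG doors, (W1) itself are untouched — (W1) is USED).  At the chain's windows (`θ_J ≲ 10⁻⁵` against `s₀ = 1∕128`) the `√θ` law is
not binding; the planner reads the regime (G1′ ∕ (P4) ∕ (P5)).

HONEST.  Arithmetic over a landed theorem; nothing of Bałaban's renormalisation-group analysis is asserted, proved or refuted ([Balaban1985RegularSpaces] Lemma 1 p.79 ∕ (1.29) p.81 ∕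
Thm 2 p.83 are LOCAL axial∕Landau gauges on cubes, never a global torus gauge — not contradicted); `hsupp`, hARC⁗, hDBX⁗, (LS), G1′ are HYPOTHESES ∕ planner items; GAP♯∘
(`stub_uniformFibreGapOrbit`, registry 3732b7df UNTOUCHED, 0∕5), the five registered stubs, S2β, crux 20520, 19936, 19200, `YM3TorusSU2` NOT proved; no registered stub closed;
rung R3 = SU(2) YM₃ on T³ — NOT d = 4, NOT infinite volume, NOT a mass gap, NOT Clay; the Yang–Mills mass gap is NOT proved.  Axioms standard.

References: T. Bałaban, CMP **99** (1985) 75–102 [Balaban1985RegularSpaces] (Lemma 1 p.79, (1.29) p.81, Thm 2 p.83); CMP **98** (1985) 17–51 [Balaban1985Averaging] ((8)–(9) pp.18–19).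
-/

set_option autoImplicit false

noncomputable section

namespace Summit.QuantumFields.YangMills.Theorems.FluctuationComparisonRegPrIntLS2BetaSmallBondGaugeLinearSupplierFalse

open scoped Real
open Literature.MathematicalPhysics.QuantumLattice (su2Quat)
open Literature.MathematicalPhysics.QuantumFieldTheory.Balaban1983to89
open T4CubeChartGnomonic (SU2)
open T3ContinuumYM3Torus (T3Family)
open T4ExpWindowSmallField (logVec)
open Summit.QuantumFields.YangMills.Theorems.FluctuationComparisonRegPrIntLS2BetaSmallBondGaugeToronObstruction (sitesPerDir_run_zero)
open Summit.QuantumFields.YangMills.Theorems.FluctuationComparisonRegPrIntLS2BetaSmallBondGaugeCurvatureFloor (not_smallBond_supplier_T3)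
open Summit.QuantumFields.YangMills.Theorems.FluctuationComparisonRegPrIntLS2BetaDistributedHolonomySU2 (norm_logVec_le_pi_div_two_mul_dist1)

/-- The volume of the witness family: `4s² < 2·3^{2s²}`. [folklore] -/
theorem two_mul_three_pow_gt (s : ℕ) : 4 * s ^ 2 < 2 * 3 ^ (2 * s ^ 2) := by
  have h : 2 * s ^ 2 < 3 ^ (2 * s ^ 2) := Nat.lt_pow_self (by norm_num)
  omega

/-- ★ **FOR EVERY `C` AN EXPLICIT FAILURE OF THE LINEAR SUPPLIER**: with `s := ⌈4πC⌉₊ + 1`, the family `F := ⟨3, 2s²⟩` (`N = 2·3^{2s²} ≥ 4s²` sites per direction on its unit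
lattice of run `0`) and `θ := 4π∕N`, it is FALSE that every `PlaqSmall θ` datum on `F.P 0` has a gauge copy with all bond arcs `≤ C·θ` ((W1) ✓`not_smallBond_supplier_T3` at `k = 1`:
the curvature floor `s∕N` beats `C·θ = 4πC∕N`). [cite: Balaban1985RegularSpaces, Lemma 1 p.79, (1.29) p.81] -/
theorem exists_family_linear_supplier_fails (C : ℝ) :
    ∃ (F : T3Family) (θ : ℝ), 0 < θ ∧
      ¬ ∀ V : GaugeField (F.P 0) 0 SU2, PlaqSmall θ V →
          ∃ u : GaugeTransf (F.P 0) 0 SU2, ∀ e : PBond (F.P 0) 0, ‖logVec (su2Quat (GaugeField.gaugeAct u V e))‖ ≤ C * θ := by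
  have hπ := Real.pi_pos
  -- the square size `s` with `4πC < s`
  set s : ℕ := ⌈4 * π * C⌉₊ + 1 with hsdef
  have hs : 0 < s := by omega
  have hCs : 4 * π * C < (s : ℝ) := by
    have h1 : 4 * π * C ≤ (⌈4 * π * C⌉₊ : ℝ) := Nat.le_ceil _
    have h2 : ((⌈4 * π * C⌉₊ : ℕ) : ℝ) + 1 = (s : ℝ) := by rw [hsdef]; push_cast; ring
    linarith
  -- the family `⟨3, 2s²⟩` at height `0`: `N = 2·3^{2s²} > 4s²`
  have hm : 1 ≤ 2 * s ^ 2 := by nlinarith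
  let F : T3Family := ⟨3, ⟨by decide, by decide⟩, 2 * s ^ 2, hm⟩
  have hN : (F.P 0).sitesPerDir 0 = 2 * 3 ^ (2 * s ^ 2) := sitesPerDir_run_zero F
  have hks : 4 * 1 * s ^ 2 ≤ (F.P 0).sitesPerDir 0 := by
    rw [hN]; have := two_mul_three_pow_gt s; omega
  have hNpos : (0 : ℝ) < ((F.P 0).sitesPerDir 0 : ℝ) := by
    rw [hN]; positivity
  -- the window `θ = 4π∕N` and the linear threshold `C·θ < s∕N`
  refine ⟨F, 4 * π / ((F.P 0).sitesPerDir 0 : ℝ), by positivity, ?_⟩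
  have hθ : 2 * π * (1 : ℕ) / ((F.P 0).sitesPerDir 0 : ℝ) < 4 * π / ((F.P 0).sitesPerDir 0 : ℝ) := by
    rw [Nat.cast_one, mul_one]
    exact div_lt_div_of_pos_right (by linarith) hNpos
  have hs₀ : C * (4 * π / ((F.P 0).sitesPerDir 0 : ℝ)) < ((1 : ℕ) * s : ℝ) / ((F.P 0).sitesPerDir 0 : ℝ) := by
    rw [Nat.cast_one, one_mul, ← mul_div_assoc]
    exact div_lt_div_of_pos_right (by linarith) hNpos
  exact not_smallBond_supplier_T3 F 0 hs hks hθ hs₀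

/-- ★★★ **NO VOLUME-UNIFORM SMALL-BOND GAUGE SUPPLIER WITH A THRESHOLD LINEAR IN THE PLAQUETTE WINDOW (arc currency)** — «the target order is `√θ`, not `θ`».
[cite: Balaban1985RegularSpaces, Lemma 1 p.79, (1.29) p.81, Thm 2 p.83] -/
theorem not_linear_smallBond_supplier :
    ¬ (∃ C : ℝ, ∀ (F : T3Family) (J : ℕ) (θ : ℝ), 0 < θ → ∀ V : GaugeField (F.P J) 0 SU2, PlaqSmall θ V →
        ∃ u : GaugeTransf (F.P J) 0 SU2, ∀ e : PBond (F.P J) 0, ‖logVec (su2Quat (GaugeField.gaugeAct u V e))‖ ≤ C * θ) := by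
  rintro ⟨C, hC⟩
  obtain ⟨F, θ, hθ, hfail⟩ := exists_family_linear_supplier_fails C
  exact hfail (hC F 0 θ hθ)

/-- ★ **THE SAME IN THE `dist1` CURRENCY** (`arc ≤ (π∕2)·dist1` on `SU(2)`, ✓`norm_logVec_le_pi_div_two_mul_dist1`): no `C` with all gauged bonds `dist1 ≤ C·θ`.
[cite: Balaban1985RegularSpaces, Lemma 1 p.79, (1.29) p.81; Balaban1985Averaging, (19)-(20) p.21] -/
theorem not_linear_smallBond_supplier_dist1 :
    ¬ (∃ C : ℝ, ∀ (F : T3Family) (J : ℕ) (θ : ℝ), 0 < θ → ∀ V : GaugeField (F.P J) 0 SU2, PlaqSmall θ V →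
        ∃ u : GaugeTransf (F.P J) 0 SU2, ∀ e : PBond (F.P J) 0, dist1 (GaugeField.gaugeAct u V e) ≤ C * θ) := by
  rintro ⟨C, hC⟩
  refine not_linear_smallBond_supplier ⟨π / 2 * C, fun F J θ hθ V hV => ?_⟩
  obtain ⟨u, hu⟩ := hC F J θ hθ V hV
  refine ⟨u, fun e => ?_⟩
  have h := norm_logVec_le_pi_div_two_mul_dist1 (GaugeField.gaugeAct u V e)
  have hπ := Real.pi_pos
  nlinarith [hu e, GaugeGroup.dist1_nonneg (GaugeField.gaugeAct u V e)]

end Summit.QuantumFields.YangMills.Theorems.FluctuationComparisonRegPrIntLS2BetaSmallBondGaugeLinearSupplierFalse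

end
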